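import Summits.QuantumFields.YangMills.Theorems.FradkinShenkerFlowSusceptibilityToPoincareOneLevelNecessity
import Summits.QuantumFields.YangMills.Theorems.FradkinShenkerFlowSusceptibilityToPoincareLevelMarginal
import Summits.QuantumFields.YangMills.Theorems.FradkinShenkerFlowSusceptibilityToPoincareTruncFiltration
import Summits.QuantumFields.YangMills.Theorems.FradkinShenkerFlowSusceptibilityToPoincareElitzurBessel

/-!
# Rider `terminalPoincare_of_up` (TP) of the line `rg-variance-cascade` (crux `SusceptibilityToPoincare`) —
**the crux conclusion UP implies stub D's terminal inequality**

Route `FradkinShenkerFlow` of `YangMills`, crux item `stmt-QuantumFields-9441`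
(`Summit.QuantumFields.YangMills.Theses.FradkinShenkerFlow.SusceptibilityToPoincare`, FS ⇒ UP),
registered skeleton `Cruxes/SusceptibilityToPoincare/Lines/rg_variance_cascade.lean`; lead c3, cycle 2,
the NECESSITY PACKAGE.  In the skeleton's vocabulary stub D (`stub_terminalPoincare`) asks, inside the
scope of the restated crux, for `A_{n−1}(F) ≤ C_T · D_{n−1}(F)`: the variance of
`E_P[F∘fst | 𝓖_{n−1}]` under the joint law `P` (the TERMINAL effective theory) is controlled by the
level-`(n−1)` single-coarse-link Dirichlet form.  THIS FILE PROVES THAT INEQUALITY FROM UP ITSELF: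
for every compact `G`, `r`, real `β`, `C` with `Var_μ F ≤ C·HB(F)` for `μ = μ_{β,S}` (all `S`, all
bounded measurable `F`), every block base `b ≥ 1`, number of levels `n`, pin strength `s`, there is
`C_T` (S-free) with `A_k(F) ≤ C_T · D_k(F)` for the top level `k = n − 1`, every side, every bounded
measurable `F`.  Consequently D is NECESSARY for the crux conclusion (and for the restated crux C″):
it cannot be refuted inside C″'s scope without refuting C″, and promoting it to an item loses nothing.

## Proof

* `𝓖_n = comap (T n) = ⊥` (`stub_truncFiltration`), so `E_P[f | 𝓖_n] = ∫ f dP` (`condExp_bot`) and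
  `A_{n−1} = ∫ (g − ∫ g dP)² dP` with `g = E_P[f | 𝓖_{n−1}]`, `∫ g = ∫ f` (`integral_condExp`).
* Doob–Dynkin (`ElitzurBessel.exists_bounded_comp_ae_eq_condExp`): `g = g₀ ∘ T k` and
  `E_P[f | 𝓖_{k,e}] = c₀^e ∘ T' k e` a.e. with bounded measurable `g₀`, `c₀^e`; the truncations
  `T k ω`, `T' k e ω` at the top level depend on `ω` only through the level-`k` block field `ω.2 k`
  (`TerminalNecessity.trunc_eq`, `TerminalNecessity.truncAt_eq`), so `g = ĝ(V^k)`,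
  `E_P[f | 𝓖_{k,e}] = ĉ_e(V^k)` with `ĉ_e` blind to the coordinate `e` (`Function.update_idem`).
* The `(U, V^k)`-marginal of `P` is the one-level joint law at block size `b^(k+1)`
  (`stub_levelMarginal`), so by `integral_map` both sides live on the one-level law, where
  `oneLevel_variance_le` (UP ⇒ `∫ (ĝ − ∫ĝ)² ≤ K Σ_e ∫ (ĝ − ĉ_e)²`) applies.

Corollaries (same file): `fineClause_of_up` — UP implies the FINE clause of stub B,
`a(F) = ∫ (F∘fst − E_P[F∘fst | 𝓖_0])² dP ≤ Var_P(F∘fst) = Var_μ(F) ≤ C·HB(F)` (projection inequality,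
`P.map fst = μ`); `coreSC_imp_terminalPoincare` — the restated crux
C″ = `simple ∧ simply connected G → ∀ r ∃ β₁ ∀ β ≥ β₁, FS → UP` implies the registered statement of
`stub_terminalPoincare` VERBATIM (`β₂ := β₁`, `n := 1`, `s := β`).  So the typed crux and C″ both imply
D: D cannot be refuted inside C″'s scope without refuting C″.
-/

noncomputable section

open MeasureTheory ProbabilityTheory
open Literature.MathematicalPhysics.QuantumFieldTheory

namespace Summit.QuantumFields.YangMills.Theorems.SusceptibilityToPoincare.RgVarianceCascade

namespace TerminalNecessity

variable {G : Type} [Group G] {S b n : ℕ}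

/-- At the top level `k = n − 1` the truncation `T k ω = (i ↦ if k ≤ i then ω.2 i else 1)` depends on
`ω` only through the level-`k` block field: `T k ω = T k (ω₀.1, update ω₀.2 k (ω.2 k))` for any
reference point `ω₀` (the only index `i : Fin n` with `k ≤ i` is `i = k`). [folklore] -/
theorem trunc_eq
    (T : ℕ → GaugeConfig 4 (2 * S + 1) G ×
        ((k : Fin n) → GaugeConfig 4 (BalabanAveraging.blockSide (2 * S + 1) (b ^ ((k : ℕ) + 1))) G) →
        ((k : Fin n) → GaugeConfig 4 (BalabanAveraging.blockSide (2 * S + 1) (b ^ ((k : ℕ) + 1))) G))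
    (hT : ∀ j ω k, T j ω k = if j ≤ (k : ℕ) then ω.2 k else fun _ => 1)
    (k : Fin n) (hk : (k : ℕ) + 1 = n)
    (ω₀ ω : GaugeConfig 4 (2 * S + 1) G ×
        ((k : Fin n) → GaugeConfig 4 (BalabanAveraging.blockSide (2 * S + 1) (b ^ ((k : ℕ) + 1))) G)) :
    T k ω = T k (ω₀.1, Function.update ω₀.2 k (ω.2 k)) := by
  funext i
  rw [hT, hT]
  by_cases hi : (k : ℕ) ≤ (i : ℕ)
  · have hik : i = k := Fin.ext (by have := i.isLt; omega)
    subst hik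
    simp
  · simp [hi]

/-- At the top level `k = n − 1` the punctured truncation `T' k e ω` (level `k` with the coordinate
`e` erased) depends on `ω` only through the level-`k` block field, and is blind to its coordinate
`e`: `T' k e ω = T' k e (ω₀.1, update ω₀.2 k (update (ω.2 k) e y))` for any `ω₀`, `y`. [folklore] -/
theorem truncAt_eq
    (T' : (k : Fin n) → Edge 4 (BalabanAveraging.blockSide (2 * S + 1) (b ^ ((k : ℕ) + 1))) →
        GaugeConfig 4 (2 * S + 1) G ×
          ((k : Fin n) → GaugeConfig 4 (BalabanAveraging.blockSide (2 * S + 1) (b ^ ((k : ℕ) + 1))) G) →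
        ((k : Fin n) → GaugeConfig 4 (BalabanAveraging.blockSide (2 * S + 1) (b ^ ((k : ℕ) + 1))) G))
    (hT' : ∀ k e ω i, T' k e ω i = if (k : ℕ) ≤ (i : ℕ) then
      Function.update ω.2 k (Function.update (ω.2 k) e 1) i else fun _ => 1)
    (k : Fin n) (hk : (k : ℕ) + 1 = n) (e : Edge 4 (BalabanAveraging.blockSide (2 * S + 1) (b ^ ((k : ℕ) + 1))))
    (ω₀ ω : GaugeConfig 4 (2 * S + 1) G ×
        ((k : Fin n) → GaugeConfig 4 (BalabanAveraging.blockSide (2 * S + 1) (b ^ ((k : ℕ) + 1))) G))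
    (y : G) :
    T' k e ω = T' k e (ω₀.1, Function.update ω₀.2 k (Function.update (ω.2 k) e y)) := by
  funext i
  rw [hT', hT']
  by_cases hi : (k : ℕ) ≤ (i : ℕ)
  · have hik : i = k := Fin.ext (by have := i.isLt; omega)
    subst hik
    simp
  · simp [hi]

/-- A truncation map all of whose coordinates are coordinate projections or constants is measurable:
here from `comap T ≤` the product σ-algebra (`stub_truncFiltration`). [folklore] -/
theorem measurable_of_comap_le {X Y : Type*} [mX : MeasurableSpace X] [mY : MeasurableSpace Y]
    {T : X → Y} (h : mY.comap T ≤ mX) : Measurable T :=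
  Measurable.of_comap_le h

end TerminalNecessity

/-! ### The registered rider -/

/-- Rider TP `terminalPoincare_of_up`: **the crux conclusion UP implies stub D's terminal
inequality.**  For every compact `G`, lattice representation `r`, real `β` and `C` such that the
Wilson measures `μ_{β,S}` satisfy the uniform heat-bath Poincaré inequality with constant `C`, every
block base `b ≥ 1`, number of levels `n` and pin strength `s`, there is `C_T` such that for every
side `2S+1`, the joint law `P` of the fine field and its smeared block fields, the truncation maps
`T`, `T'` of the skeleton, every bounded measurable `F` and the top level `k` (`k + 1 = n`):
`∫ (E_P[F∘fst | comap (T k)] − E_P[F∘fst | comap (T (k+1))])² dP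
   ≤ C_T Σ_e ∫ (E_P[F∘fst | comap (T k)] − E_P[F∘fst | comap (T' k e)])² dP`
— i.e. `A_{n−1}(F) ≤ C_T · D_{n−1}(F)` in the notation of the line card.  See the module docstring
for the proof (`stub_truncFiltration`, `condExp_bot`, Doob–Dynkin, `stub_levelMarginal`,
`oneLevel_variance_le`). [folklore] -/
theorem terminalPoincare_of_up :
        ∀ (G : Type) [Group G] [TopologicalSpace G] [IsTopologicalGroup G] [CompactSpace G]
      [MeasurableSpace G] [BorelSpace G] (r : LatticeRep G) (β C : ℝ),
      (∀ (S : ℕ) (F : GaugeConfig 4 (2 * S + 1) G → ℝ), Measurable F → (∃ M : ℝ, ∀ U, |F U| ≤ M) →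
        variance F (wilsonMeasure r.ρ β : Measure (GaugeConfig 4 (2 * S + 1) G)) ≤
          C * ∑ ℓ : Edge 4 (2 * S + 1), ∫ U, ∫ g, (F U - F (Function.update U ℓ g)) ^ 2
            ∂((haarProbability G).tilted (fun g' => -β * wilsonAction r.ρ (Function.update U ℓ g')))
            ∂(wilsonMeasure r.ρ β : Measure (GaugeConfig 4 (2 * S + 1) G))) →
      ∀ (b : ℕ) [NeZero b] (n : ℕ) (s : ℝ), ∃ CT : ℝ, ∀ (S : ℕ)
        (P : Measure (GaugeConfig 4 (2 * S + 1) G × ((k : Fin n) → GaugeConfig 4 (BalabanAveraging.blockSide (2 * S + 1) (b ^ ((k : ℕ) + 1))) G))),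
        P = ((wilsonMeasure r.ρ β : Measure (GaugeConfig 4 (2 * S + 1) G)).prod
          (Measure.pi fun k : Fin n => Measure.pi
            fun _ : Edge 4 (BalabanAveraging.blockSide (2 * S + 1) (b ^ ((k : ℕ) + 1))) => haarProbability G)).tilted
          (fun ω => ∑ k : Fin n, ∑ e : Edge 4 (BalabanAveraging.blockSide (2 * S + 1) (b ^ ((k : ℕ) + 1))),
            s * (r.ρ (ω.2 k e * (BalabanAveraging.link (2 * S + 1) (b ^ ((k : ℕ) + 1))
              (BalabanAveraging.BlockMean.rep 0) ω.1 e)⁻¹)).trace.re) →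
        ∀ (T : ℕ → GaugeConfig 4 (2 * S + 1) G × ((k : Fin n) → GaugeConfig 4 (BalabanAveraging.blockSide (2 * S + 1) (b ^ ((k : ℕ) + 1))) G) → ((k : Fin n) → GaugeConfig 4 (BalabanAveraging.blockSide (2 * S + 1) (b ^ ((k : ℕ) + 1))) G)),
        (∀ j ω k, T j ω k = if j ≤ (k : ℕ) then ω.2 k else fun _ => 1) →
        ∀ (T' : (k : Fin n) → Edge 4 (BalabanAveraging.blockSide (2 * S + 1) (b ^ ((k : ℕ) + 1))) →
          GaugeConfig 4 (2 * S + 1) G × ((k : Fin n) → GaugeConfig 4 (BalabanAveraging.blockSide (2 * S + 1) (b ^ ((k : ℕ) + 1))) G) → ((k : Fin n) → GaugeConfig 4 (BalabanAveraging.blockSide (2 * S + 1) (b ^ ((k : ℕ) + 1))) G)),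
        (∀ k e ω i, T' k e ω i = if (k : ℕ) ≤ (i : ℕ) then
          Function.update ω.2 k (Function.update (ω.2 k) e 1) i else fun _ => 1) →
        ∀ (F : GaugeConfig 4 (2 * S + 1) G → ℝ), Measurable F → (∃ M : ℝ, ∀ U, |F U| ≤ M) →
        ∀ k : Fin n, (k : ℕ) + 1 = n →
        ∫ ω, (condExp (MeasurableSpace.comap (T k) inferInstance) P (F ∘ Prod.fst) ω -
            condExp (MeasurableSpace.comap (T ((k : ℕ) + 1)) inferInstance) P (F ∘ Prod.fst) ω) ^ 2 ∂P ≤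
          CT * ∑ e : Edge 4 (BalabanAveraging.blockSide (2 * S + 1) (b ^ ((k : ℕ) + 1))),
            ∫ ω, (condExp (MeasurableSpace.comap (T k) inferInstance) P (F ∘ Prod.fst) ω -
              condExp (MeasurableSpace.comap (T' k e) inferInstance) P (F ∘ Prod.fst) ω) ^ 2 ∂P := by
  intro G _ _ _ _ _ _ r β C hUP b _ n s
  -- one constant per level (only the top level is used): `C_T = Σ_k |K_k|`
  choose K hK using fun k : Fin n => oneLevel_variance_le G r β C hUP (b ^ ((k : ℕ) + 1)) s
  refine ⟨∑ k, |K k|, ?_⟩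
  intro S P hP T hT T' hT' F hF hFb k hk
  obtain ⟨M, hM⟩ := hFb
  have hM0 : 0 ≤ M := (abs_nonneg _).trans (hM (fun _ => 1))
  haveI : SecondCountableTopology G :=
    (r.continuous.isClosedEmbedding r.injective).isEmbedding.secondCountableTopology
  obtain ⟨hPprob, -⟩ := stub_jointMarginal G r β b n s S P hP
  haveI := hPprob
  -- the filtration facts
  obtain ⟨hle, -, hbot⟩ := stub_truncFiltration G S b n T hT
  have hkn : T ((k : ℕ) + 1) = T n := by rw [hk]
  -- abbreviations
  set f : GaugeConfig 4 (2 * S + 1) G ×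
      ((k : Fin n) → GaugeConfig 4 (BalabanAveraging.blockSide (2 * S + 1) (b ^ ((k : ℕ) + 1))) G) → ℝ :=
    F ∘ Prod.fst with hf_def
  have hfM : ∀ ω, |f ω| ≤ M := fun ω => hM ω.1
  have hfm : Measurable f := hF.comp measurable_fst
  -- Doob–Dynkin versions
  obtain ⟨g₀, hg₀m, hg₀M, hg₀⟩ := ElitzurBessel.exists_bounded_comp_ae_eq_condExp
    (μ := P) (π := T k) (φ := f) hM0 hfM
  choose c₀ hc₀m hc₀M hc₀ using fun e : Edge 4 (BalabanAveraging.blockSide (2 * S + 1) (b ^ ((k : ℕ) + 1))) =>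
    ElitzurBessel.exists_bounded_comp_ae_eq_condExp (μ := P) (π := T' k e) (φ := f) hM0 hfM
  -- reference point and the level-k parametrisations
  set ω₀ : GaugeConfig 4 (2 * S + 1) G ×
      ((k : Fin n) → GaugeConfig 4 (BalabanAveraging.blockSide (2 * S + 1) (b ^ ((k : ℕ) + 1))) G) :=
    (fun _ => 1, fun _ _ => 1) with hω₀_def
  set ĝ : GaugeConfig 4 (BalabanAveraging.blockSide (2 * S + 1) (b ^ ((k : ℕ) + 1))) G → ℝ :=
    fun V => g₀ (T k (ω₀.1, Function.update ω₀.2 k V)) with hĝ_def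
  set ĉ : Edge 4 (BalabanAveraging.blockSide (2 * S + 1) (b ^ ((k : ℕ) + 1))) →
      GaugeConfig 4 (BalabanAveraging.blockSide (2 * S + 1) (b ^ ((k : ℕ) + 1))) G → ℝ :=
    fun e V => c₀ e (T' k e (ω₀.1, Function.update ω₀.2 k (Function.update V e 1))) with hĉ_def
  have hTm : Measurable (T k) := TerminalNecessity.measurable_of_comap_le (hle k)
  have hT'm : ∀ e, Measurable (T' k e) := by
    intro e
    refine measurable_pi_lambda _ fun i => ?_
    simp_rw [hT']
    by_cases hi : (k : ℕ) ≤ (i : ℕ)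
    · simp only [if_pos hi]
      have hik : i = k := Fin.ext (by have := i.isLt; omega)
      subst hik
      simp only [Function.update_self]
      exact measurable_update_left.comp ((measurable_pi_apply i).comp measurable_snd)
    · simp only [if_neg hi]
      exact measurable_const
  have hupd : Measurable fun V : GaugeConfig 4 (BalabanAveraging.blockSide (2 * S + 1) (b ^ ((k : ℕ) + 1))) G =>
      (ω₀.1, Function.update ω₀.2 k V) := measurable_const.prodMk (measurable_update ω₀.2)
  have hĝm : Measurable ĝ := hg₀m.comp (hTm.comp hupd)
  have hĉm : ∀ e, Measurable (ĉ e) := fun e =>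
    (hc₀m e).comp ((hT'm e).comp (measurable_const.prodMk
      ((measurable_update ω₀.2).comp measurable_update_left)))
  have hĉfree : ∀ e V y, ĉ e (Function.update V e y) = ĉ e V := fun e V y => by
    simp only [hĉ_def, Function.update_idem]
  -- the parametrisations recover the Doob–Dynkin versions
  have hĝT : ∀ ω, ĝ (ω.2 k) = g₀ (T k ω) := fun ω => by
    simp only [hĝ_def]
    rw [← TerminalNecessity.trunc_eq T hT k hk ω₀ ω]
  have hĉT : ∀ e ω, ĉ e (ω.2 k) = c₀ e (T' k e ω) := fun e ω => by
    simp only [hĉ_def]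
    rw [← TerminalNecessity.truncAt_eq T' hT' k hk e ω₀ ω 1]
  -- the top martingale increment is a variance
  have hconst : condExp (MeasurableSpace.comap (T ((k : ℕ) + 1)) inferInstance) P f =
      fun _ => ∫ ω, f ω ∂P := by
    rw [hkn, hbot]; exact condExp_bot f
  have hmean : ∫ ω, f ω ∂P = ∫ ω, ĝ (ω.2 k) ∂P := by
    rw [← integral_condExp (hle k) (f := f)]
    refine integral_congr_ae ?_
    filter_upwards [hg₀] with ω hω
    rw [← hω, hĝT]
  -- the (U, V^k)-marginal is the one-level law
  have hmarg := stub_levelMarginal G r β b n s S P hP k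
  have hpm : Measurable fun ω : GaugeConfig 4 (2 * S + 1) G ×
      ((k : Fin n) → GaugeConfig 4 (BalabanAveraging.blockSide (2 * S + 1) (b ^ ((k : ℕ) + 1))) G) =>
      (ω.1, ω.2 k) := measurable_fst.prodMk ((measurable_pi_apply k).comp measurable_snd)
  have htr : ∀ {φ : GaugeConfig 4 (2 * S + 1) G ×
        GaugeConfig 4 (BalabanAveraging.blockSide (2 * S + 1) (b ^ ((k : ℕ) + 1))) G → ℝ},
      Measurable φ → ∫ z, φ z ∂(P.map fun ω => (ω.1, ω.2 k)) = ∫ ω, φ (ω.1, ω.2 k) ∂P :=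
    fun hφ => integral_map hpm.aemeasurable hφ.aestronglyMeasurable
  -- the one-level necessity inequality at block size `b^(k+1)`
  have hOL := hK k S (P.map fun ω => (ω.1, ω.2 k)) hmarg ĝ hĝm ⟨M, fun V => hg₀M _⟩ ĉ hĉm
    (fun e => ⟨M, fun V => hc₀M e _⟩) hĉfree
  set mP : ℝ := ∫ z, ĝ z.2 ∂(P.map fun ω => (ω.1, ω.2 k)) with hmP
  have e0 : mP = ∫ ω, ĝ (ω.2 k) ∂P := htr (φ := fun z => ĝ z.2) (hĝm.comp measurable_snd)
  have e1 : ∫ z, (ĝ z.2 - mP) ^ 2 ∂(P.map fun ω => (ω.1, ω.2 k)) = ∫ ω, (ĝ (ω.2 k) - mP) ^ 2 ∂P :=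
    htr (φ := fun z => (ĝ z.2 - mP) ^ 2) (((hĝm.comp measurable_snd).sub_const mP).pow_const 2)
  have e2 : ∀ e, ∫ z, (ĝ z.2 - ĉ e z.2) ^ 2 ∂(P.map fun ω => (ω.1, ω.2 k)) =
      ∫ ω, (ĝ (ω.2 k) - ĉ e (ω.2 k)) ^ 2 ∂P := fun e =>
    htr (φ := fun z => (ĝ z.2 - ĉ e z.2) ^ 2)
      (((hĝm.comp measurable_snd).sub ((hĉm e).comp measurable_snd)).pow_const 2)
  rw [e1, e0] at hOL
  simp_rw [e2] at hOL
  -- left-hand side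
  have hL : ∫ ω, (condExp (MeasurableSpace.comap (T k) inferInstance) P f ω -
      condExp (MeasurableSpace.comap (T ((k : ℕ) + 1)) inferInstance) P f ω) ^ 2 ∂P =
      ∫ ω, (ĝ (ω.2 k) - ∫ ω', ĝ (ω'.2 k) ∂P) ^ 2 ∂P := by
    rw [hconst, hmean]
    refine integral_congr_ae ?_
    filter_upwards [hg₀] with ω hω
    rw [← hω, hĝT]
  -- right-hand side
  have hR : ∀ e, ∫ ω, (condExp (MeasurableSpace.comap (T k) inferInstance) P f ω -
      condExp (MeasurableSpace.comap (T' k e) inferInstance) P f ω) ^ 2 ∂P =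
      ∫ ω, (ĝ (ω.2 k) - ĉ e (ω.2 k)) ^ 2 ∂P := fun e => by
    refine integral_congr_ae ?_
    filter_upwards [hg₀, hc₀ e] with ω hω hω'
    rw [← hω, ← hω', hĝT, hĉT]
  rw [hL]
  simp_rw [hR]
  refine hOL.trans ?_
  have hsum0 : 0 ≤ ∑ e, ∫ ω, (ĝ (ω.2 k) - ĉ e (ω.2 k)) ^ 2 ∂P :=
    Finset.sum_nonneg fun e _ => integral_nonneg fun ω => sq_nonneg _
  exact mul_le_mul_of_nonneg_right ((le_abs_self _).trans
    (Finset.single_le_sum (fun i _ => abs_nonneg (K i)) (Finset.mem_univ k))) hsum0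

/-! ### Corollaries: the fine clause, and C″ ⇒ D verbatim -/

/-- Rider `fineClause_of_up`: **UP implies the fine clause of stub B (`stub_fluctuationPoincare`).**
For every compact `G`, `r`, real `β`, `C` with `Var_μ F ≤ C · HB(F)` for `μ = μ_{β,S}` (all `S`, all
bounded measurable `F`), every block base `b ≥ 1`, `n`, `s`, side `2S+1`, the joint law `P`, the
truncation maps `T` and every bounded measurable `F`:
`∫ (F∘fst − E_P[F∘fst | comap (T 0)])² dP ≤ C · HB(F)` — the residual after conditioning on all block
fields is at most the residual after the constant `∫ F∘fst dP` (projection inequality), i.e. the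
variance of `F∘fst` under `P`, which is `Var_μ(F)` because `P.map fst = μ` (`stub_jointMarginal`).
[folklore] -/
theorem fineClause_of_up :
        ∀ (G : Type) [Group G] [TopologicalSpace G] [IsTopologicalGroup G] [CompactSpace G]
      [MeasurableSpace G] [BorelSpace G] (r : LatticeRep G) (β C : ℝ),
      (∀ (S : ℕ) (F : GaugeConfig 4 (2 * S + 1) G → ℝ), Measurable F → (∃ M : ℝ, ∀ U, |F U| ≤ M) →
        variance F (wilsonMeasure r.ρ β : Measure (GaugeConfig 4 (2 * S + 1) G)) ≤
          C * ∑ ℓ : Edge 4 (2 * S + 1), ∫ U, ∫ g, (F U - F (Function.update U ℓ g)) ^ 2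
            ∂((haarProbability G).tilted (fun g' => -β * wilsonAction r.ρ (Function.update U ℓ g')))
            ∂(wilsonMeasure r.ρ β : Measure (GaugeConfig 4 (2 * S + 1) G))) →
      ∀ (b : ℕ) [NeZero b] (n : ℕ) (s : ℝ) (S : ℕ) (P : Measure (GaugeConfig 4 (2 * S + 1) G × ((k : Fin n) → GaugeConfig 4 (BalabanAveraging.blockSide (2 * S + 1) (b ^ ((k : ℕ) + 1))) G))),
        P = ((wilsonMeasure r.ρ β : Measure (GaugeConfig 4 (2 * S + 1) G)).prod
          (Measure.pi fun k : Fin n => Measure.pi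
            fun _ : Edge 4 (BalabanAveraging.blockSide (2 * S + 1) (b ^ ((k : ℕ) + 1))) => haarProbability G)).tilted
          (fun ω => ∑ k : Fin n, ∑ e : Edge 4 (BalabanAveraging.blockSide (2 * S + 1) (b ^ ((k : ℕ) + 1))),
            s * (r.ρ (ω.2 k e * (BalabanAveraging.link (2 * S + 1) (b ^ ((k : ℕ) + 1))
              (BalabanAveraging.BlockMean.rep 0) ω.1 e)⁻¹)).trace.re) →
        ∀ (T : ℕ → GaugeConfig 4 (2 * S + 1) G × ((k : Fin n) → GaugeConfig 4 (BalabanAveraging.blockSide (2 * S + 1) (b ^ ((k : ℕ) + 1))) G) → ((k : Fin n) → GaugeConfig 4 (BalabanAveraging.blockSide (2 * S + 1) (b ^ ((k : ℕ) + 1))) G)),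
        (∀ j ω k, T j ω k = if j ≤ (k : ℕ) then ω.2 k else fun _ => 1) →
        ∀ (F : GaugeConfig 4 (2 * S + 1) G → ℝ), Measurable F → (∃ M : ℝ, ∀ U, |F U| ≤ M) →
        ∫ ω, (F ω.1 - condExp (MeasurableSpace.comap (T 0) inferInstance) P (F ∘ Prod.fst) ω) ^ 2 ∂P ≤
          C * ∑ ℓ : Edge 4 (2 * S + 1), ∫ U, ∫ g, (F U - F (Function.update U ℓ g)) ^ 2
            ∂((haarProbability G).tilted (fun g' => -β * wilsonAction r.ρ (Function.update U ℓ g')))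
            ∂(wilsonMeasure r.ρ β : Measure (GaugeConfig 4 (2 * S + 1) G)) := by
  intro G _ _ _ _ _ _ r β C hUP b _ n s S P hP T hT F hF hFb
  obtain ⟨M, hM⟩ := hFb
  haveI : SecondCountableTopology G :=
    (r.continuous.isClosedEmbedding r.injective).isEmbedding.secondCountableTopology
  obtain ⟨hPprob, hPfst⟩ := stub_jointMarginal G r β b n s S P hP
  haveI := hPprob
  obtain ⟨hle, -, -⟩ := stub_truncFiltration G S b n T hT
  -- the projection inequality with the constant `∫ F∘fst dP`
  have hf2 : MemLp (F ∘ Prod.fst) 2 P :=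
    MemLp.of_bound (hF.comp measurable_fst).aestronglyMeasurable M
      (ae_of_all P fun ω => (Real.norm_eq_abs _).trans_le (hM ω.1))
  have hproj := PinnedGlauber.integral_sub_condExp_sq_le_integral_sub_sq (μ := P) (hle 0) hf2
    (memLp_const (∫ ω, (F ∘ Prod.fst) ω ∂P)) stronglyMeasurable_const
  refine hproj.trans ?_
  -- the residual after the constant is the variance of `F` under `μ = P.map fst`
  have hvarP : ∫ ω, ((F ∘ Prod.fst) ω - ∫ ω', (F ∘ Prod.fst) ω' ∂P) ^ 2 ∂P =
      variance F (wilsonMeasure r.ρ β : Measure (GaugeConfig 4 (2 * S + 1) G)) := by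
    rw [← hPfst, variance_eq_integral (hF.aemeasurable),
      integral_map measurable_fst.aemeasurable hF.aestronglyMeasurable,
      integral_map measurable_fst.aemeasurable
        (((hF.sub_const _).pow_const 2).aestronglyMeasurable)]
    rfl
  rw [hvarP]
  exact hUP S F hF ⟨M, hM⟩

/-- Rider `coreSC_imp_terminalPoincare`: **the restated crux C″ implies the registered statement of
stub D (`stub_terminalPoincare`) verbatim.**  Given
`C″ : ∀ simple simply-connected G, ∀ r, ∃ β₁, ∀ β ≥ β₁, FS r β → UP r β`, take `β₂ := β₁`; for
`β ≥ β₂` with FS get UP with some constant `C`, choose `n := 1`, `s := β` and the constant `C_T` of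
`terminalPoincare_of_up`.  (The hypotheses `IsCompactSimpleLieGroup`, `SimplyConnectedSpace`, `2 ≤ b`
and FS are only passed through.) [folklore] -/
theorem coreSC_imp_terminalPoincare :
        (∀ (G : Type) [Group G] [TopologicalSpace G] [IsTopologicalGroup G] [CompactSpace G] [MeasurableSpace G] [BorelSpace G], IsCompactSimpleLieGroup G → SimplyConnectedSpace G → ∀ (r : LatticeRep G), ∃ β₁ : ℝ, ∀ β : ℝ, β₁ ≤ β → (∀ A B : YMSpecies G, ∃ χ : ℝ, ∀ S : ℕ, ∑ x ∈ Literature.Probability.LatticeModels.box 4 S, |covariance (fun U => A.F (Literature.MathematicalPhysics.QuantumLattice.torusLift (2 * S + 1) U)) (fun U => B.F (Literature.MathematicalPhysics.QuantumLattice.configShift (-x) (Literature.MathematicalPhysics.QuantumLattice.torusLift (2 * S + 1) U))) (wilsonMeasure r.ρ β : Measure (GaugeConfig 4 (2 * S + 1) G))| ≤ χ) → (∃ C : ℝ, ∀ S : ℕ, ∀ F : GaugeConfig 4 (2 * S + 1) G → ℝ, Measurable F → (∃ M : ℝ, ∀ U, |F U| ≤ M) → variance F (wilsonMeasure r.ρ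 β : Measure (GaugeConfig 4 (2 * S + 1) G)) ≤ C * ∑ ℓ : Edge 4 (2 * S + 1), ∫ U, ∫ g, (F U - F (Function.update U ℓ g)) ^ 2 ∂((haarProbability G).tilted (fun g' => -β * wilsonAction r.ρ (Function.update U ℓ g'))) ∂(wilsonMeasure r.ρ β : Measure (GaugeConfig 4 (2 * S + 1) G)))) →
    ∀ (G : Type) [Group G] [TopologicalSpace G] [IsTopologicalGroup G] [CompactSpace G] [MeasurableSpace G] [BorelSpace G], IsCompactSimpleLieGroup G → SimplyConnectedSpace G → ∀ (r : LatticeRep G) (b : ℕ) [NeZero b], 2 ≤ b → ∃ β₂ : ℝ, ∀ β : ℝ, β₂ ≤ β → (∀ A B : YMSpecies G, ∃ χ : ℝ, ∀ S : ℕ, ∑ x ∈ Literature.Probability.LatticeModels.box 4 S, |covariance (fun U => A.F (Literature.MathematicalPhysics.QuantumLattice.torusLift (2 * S + 1) U)) (fun U => B.F (Literature.MathematicalPhysics.QuantumLattice.configShift (-x) (Literature.MathematicalPhysics.QuantumLattice.torusLift (2 * S + 1) U))) (wilsonMeasure r.ρ β : Measure (GaugeConfig 4 (2 * S + 1) G))|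 ≤ χ) → ∃ n : ℕ, 1 ≤ n ∧ ∃ s : ℝ, β ≤ s ∧ ∃ C : ℝ, ∀ (S : ℕ) (P : Measure (GaugeConfig 4 (2 * S + 1) G × ((k : Fin n) → GaugeConfig 4 (BalabanAveraging.blockSide (2 * S + 1) (b ^ ((k : ℕ) + 1))) G))), P = ((wilsonMeasure r.ρ β : Measure (GaugeConfig 4 (2 * S + 1) G)).prod (Measure.pi fun k : Fin n => Measure.pi fun _ : Edge 4 (BalabanAveraging.blockSide (2 * S + 1) (b ^ ((k : ℕ) + 1))) => haarProbability G)).tilted (fun ω => ∑ k : Fin n, ∑ e : Edge 4 (BalabanAveraging.blockSide (2 * S + 1) (b ^ ((k : ℕ) + 1))), s * (r.ρ (ω.2 k e * (BalabanAveraging.link (2 * S + 1) (b ^ ((k : ℕ) + 1)) (BalabanAveraging.BlockMean.rep 0) ω.1 e)⁻¹)).trace.re) → ∀ (T : ℕ → GaugeConfig 4 (2 * S + 1) G × ((k : Fin n) → GaugeConfig 4 (BalabanAveraging.blockSide (2 * S + 1) (b ^ ((k : ℕ) + 1))) G) → ((k : Fin n) → GaugeConfig 4 (BalabanAveraging.blockSide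 (2 * S + 1) (b ^ ((k : ℕ) + 1))) G)), (∀ j ω k, T j ω k = if j ≤ (k : ℕ) then ω.2 k else fun _ => 1) → ∀ (T' : (k : Fin n) → Edge 4 (BalabanAveraging.blockSide (2 * S + 1) (b ^ ((k : ℕ) + 1))) → GaugeConfig 4 (2 * S + 1) G × ((k : Fin n) → GaugeConfig 4 (BalabanAveraging.blockSide (2 * S + 1) (b ^ ((k : ℕ) + 1))) G) → ((k : Fin n) → GaugeConfig 4 (BalabanAveraging.blockSide (2 * S + 1) (b ^ ((k : ℕ) + 1))) G)), (∀ k e ω i, T' k e ω i = if (k : ℕ) ≤ (i : ℕ) then Function.update ω.2 k (Function.update (ω.2 k) e 1) i else fun _ => 1) → ∀ (F : GaugeConfig 4 (2 * S + 1) G → ℝ), Measurable F → (∃ M : ℝ, ∀ U, |F U| ≤ M) → ∀ k : Fin n, (k : ℕ) + 1 = n → ∫ ω, (condExp (MeasurableSpace.comap (T k) inferInstance) P (F ∘ Prod.fst) ω - condExp (MeasurableSpace.comap (T ((k : ℕ) + 1)) inferInstance) P (F ∘ Prod.fst) ω) ^ 2 ∂P ≤ C * ∑ e : Edge 4 (BalabanAveraging.blockSide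 (2 * S + 1) (b ^ ((k : ℕ) + 1))), ∫ ω, (condExp (MeasurableSpace.comap (T k) inferInstance) P (F ∘ Prod.fst) ω - condExp (MeasurableSpace.comap (T' k e) inferInstance) P (F ∘ Prod.fst) ω) ^ 2 ∂P := by
  intro hcore G _ _ _ _ _ _ hG hsc r b _ _hb
  obtain ⟨β₁, hβ₁⟩ := hcore G hG hsc r
  refine ⟨β₁, fun β hβ hFS => ?_⟩
  obtain ⟨C, hC⟩ := hβ₁ β hβ hFS
  obtain ⟨CT, hCT⟩ := terminalPoincare_of_up G r β C hC b 1 β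
  exact ⟨1, le_rfl, β, le_rfl, CT, fun S P hP T hT T' hT' F hF hFb k hk =>
    hCT S P hP T hT T' hT' F hF hFb k hk⟩

end Summit.QuantumFields.YangMills.Theorems.SusceptibilityToPoincare.RgVarianceCascade

end
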